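import Mathlib.Analysis.InnerProductSpace.Calculus
import Literature.Analysis.FluidPDE.CompressibleEulerClassicalGlue
import Literature.Analysis.FluidPDE.ClassicalEulerPointData
import Literature.Analysis.FunctionSpaces.TorusCalculusProofs
import Literature.Analysis.FunctionSpaces.TorusChainRule
import Literature.Analysis.FunctionSpaces.TorusSpaceTime
import Literature.Analysis.FunctionSpaces.TorusTestFunction
import HarnessLib

/-!
# The complete Euler system in primitive variables: equivalence with the conservative form for
# smooth solutions

Analysis/FluidPDE support file (everything proved), layer L0 of the programme to discharge
`Literature.Analysis.FluidPDE.CompressibleEulerLocalWellPosedness` (Majda 1984, Ch. 2,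
Thms 2.1–2.2). The local existence theory (Kato 1975, Majda 1984, Dafermos 2005 §5.1) treats the
complete Euler system of a compressible fluid as a quasilinear symmetric hyperbolic system in the
PRIMITIVE unknowns `(ρ, u, ϑ)` (Majda 1984, Ch. 1, the basic example; symmetriser
`diag(p_ρ/ρ, ρI₃, ρ e_ϑ/ϑ)`), whereas the solution notion of the tree,
`CompressibleEuler.IsClassicalEulerSolution[On]` (Březina–Feireisl (1.1)–(1.3)), is the system
of CONSERVATION LAWS for `[ρ, ρu, ρ(|u|²/2 + e)]`. For smooth fields with `ρ > 0` the two are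
equivalent; this file proves the equivalence on the flat torus `𝕋^d`, through three pointwise
algebraic identities valid for ARBITRARY smooth fields `ρ, u, p, ε` (no equation is used):

* `massFlux_identity` — `∂ₜρ + div(ρu) = ∂ₜρ + ∑ᵢ uᵢ∂ᵢρ + ρ div u`;
* `momentumFlux_identity` —
  `∂ₜ(ρu) + ∑ᵢ ∂ᵢ(ρuᵢu) + ∇p = ρ • (∂ₜu + ∑ᵢ uᵢ ∂ᵢu + ρ⁻¹∇p) + (∂ₜρ + div(ρu)) • u`;
* `energyFlux_identity` — with `k = |u|²/2 + ε`, `E = ρk`: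
  `∂ₜE + div((E + p)u) = k (∂ₜρ + ∑ᵢuᵢ∂ᵢρ + ρ div u) + ρ ⟪u, ∂ₜu + ∑ᵢuᵢ∂ᵢu + ρ⁻¹∇p⟫
   + ρ (∂ₜε + ∑ᵢ uᵢ∂ᵢε + p ρ⁻¹ div u)`;

and then

* `CompressibleEuler.IsPrimitiveEulerSolutionOn eos S ρ u ϑ` — jointly smooth `ρ, u, ϑ` on
  `S × 𝕋³`, `ρ, ϑ > 0`, and pointwise `∂ₜρ + u·∇ρ + ρ div u = 0`,
  `∂ₜu + (u·∇)u + ρ⁻¹∇p(ρ,ϑ) = 0`, `∂ₜe(ρ,ϑ) + u·∇e(ρ,ϑ) + (p(ρ,ϑ)/ρ) div u = 0`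
  (one-sided time derivatives within `S`);
* `isClassicalEulerSolutionOn_iff_primitive` — for `p`, `e` smooth on `ρ, ϑ > 0` and a time
  set of unique differentiability, `IsClassicalEulerSolutionOn eos S ↔ IsPrimitiveEulerSolutionOn eos S`;
* the monatomic athermal law `EulerEOS.monatomicExcess ζ f` (`p = ρϑζ(ρ)`, `e = 3ϑ/2`):
  `IsPrimitiveEulerSolutionOn.temperature_eq` / `IsPrimitiveEulerSolutionOn.of_monatomicExcess` —
  the internal-energy equation is the temperature equation `∂ₜϑ + u·∇ϑ + (2/3) ϑ ζ(ρ) div u = 0`.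

All of it is folklore calculus (product rules for `Torus.timeDerivWithin`, `Torus.partialDeriv`,
`Torus.divergence`, `Torus.gradient` from `TorusCalculusProofs` / `TorusSpaceTime` /
`TorusChainRule` (`Torus.divergence_smul`) / `ClassicalEulerPointData` (`timeDerivWithin_mul`,
`timeDerivWithin_smul`)). The point-data relations `IsClassicalEulerSolution.massEq_pointData` /
`momentumEq_pointData` of `ClassicalEulerPointData.lean` are the conservative ⇒ primitive
direction at a single point for a Gibbs law; here both directions are packaged as solution
notions on a time set, for an arbitrary smooth `(p, e)`.

## References

* A. Majda, *Compressible Fluid Flow and Systems of Conservation Laws in Several Space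
  Variables*, Appl. Math. Sci. 53, Springer 1984, Ch. 1 (the Euler equations of compressible
  flow as a symmetrisable system), Ch. 2 §2.1. [`Majda1984`]
* C. M. Dafermos, *Hyperbolic Conservation Laws in Continuum Physics*, 2nd ed. (2005), §3.3.6
  (thermoelastic fluids: conservative vs. primitive forms), §5.1. [`Dafermos2005`]
* J. Březina, E. Feireisl, J. Math. Soc. Japan 70 (2018), (1.1)–(1.3). [`BrezinaFeireisl2018`]
-/

noncomputable section

open Set Function Filter
open scoped ContDiff _root_.Topology InnerProductSpace

namespace Literature.Analysis.FluidPDE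

namespace CompressibleEuler

open Literature.Analysis.FunctionSpaces

/-! ## Pointwise calculus identities on `𝕋^d` -/

section Calculus

variable {d : Type*} [Fintype d] [DecidableEq d]
variable {F : Type*} [NormedAddCommGroup F] [NormedSpace ℝ F]

omit [DecidableEq d] in
/-- Coordinates of a `C¹` vector field on the torus are `C¹`. [folklore] -/
theorem isContDiff_coord {n : WithTop ℕ∞} {b : UnitAddTorus d → EuclideanSpace ℝ d}
    (hb : FunctionSpaces.Torus.IsContDiff n b) (i : d) :
    FunctionSpaces.Torus.IsContDiff n (fun y => b y i) :=
  (EuclideanSpace.proj i : EuclideanSpace ℝ d →L[ℝ] ℝ).contDiff.comp hb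

/-- Partial derivatives of `‖u‖² / 2`: `∂ᵢ(‖u‖²/2)(x) = ⟪u(x), ∂ᵢu(x)⟫` for `C¹` `u` (inner-product
form of `Torus.partialDeriv_half_norm_sq`). [folklore] -/
theorem partialDeriv_half_norm_sq_eq_inner {G : Type*} [NormedAddCommGroup G] [InnerProductSpace ℝ G]
    {b : UnitAddTorus d → G} (hb : FunctionSpaces.Torus.IsContDiff 1 b) (i : d) (x : UnitAddTorus d) :
    FunctionSpaces.Torus.partialDeriv i (fun y => ‖b y‖ ^ 2 / 2) x =
      ⟪b x, FunctionSpaces.Torus.partialDeriv i b x⟫_ℝ := by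
  have h2 : FunctionSpaces.Torus.IsContDiff 1 (fun y => ‖b y‖ ^ 2) := hb.norm_sq ℝ
  have hh : (fun y => ‖b y‖ ^ 2 / 2) = (2 : ℝ)⁻¹ • fun y => ‖b y‖ ^ 2 := by
    funext y; simp [div_eq_inv_mul]
  rw [hh, congrFun (FunctionSpaces.Torus.partialDeriv_const_smul h2 _ i) x, Pi.smul_apply,
    FunctionSpaces.Torus.partialDeriv_eq_fderiv_apply h2,
    FunctionSpaces.Torus.fderiv_norm_sq_apply hb, ← FunctionSpaces.Torus.partialDeriv_eq_fderiv_apply hb,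
    smul_eq_mul]
  ring

/-- `⟪u(x), ∇θ(x)⟫ = ∑ᵢ uᵢ(x) ∂ᵢθ(x)` for `C¹` scalar `θ`. [folklore] -/
theorem inner_gradient_eq_sum {θ : UnitAddTorus d → ℝ} (hθ : FunctionSpaces.Torus.IsContDiff 1 θ)
    (w : EuclideanSpace ℝ d) (x : UnitAddTorus d) :
    ⟪w, FunctionSpaces.Torus.gradient θ x⟫_ℝ = ∑ i, w i * FunctionSpaces.Torus.partialDeriv i θ x := by
  rw [real_inner_comm, FunctionSpaces.Torus.inner_gradient_left,
    FunctionSpaces.Torus.fderiv_apply_eq_sum_partialDeriv hθ]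
  simp [smul_eq_mul]

variable {S : Set ℝ}

omit [DecidableEq d] in
/-- The one-sided time derivative of the specific total energy `‖u‖²/2 + ε` of jointly smooth
fields: `∂ₜ(‖u‖²/2 + ε) = ⟪u, ∂ₜu⟫ + ∂ₜε`. [folklore] -/
theorem timeDerivWithin_half_norm_sq_add {G : Type*} [NormedAddCommGroup G] [InnerProductSpace ℝ G]
    {b : ℝ → UnitAddTorus d → G} {ε : ℝ → UnitAddTorus d → ℝ}
    (hb : FunctionSpaces.Torus.IsSmoothSpaceTimeOn S b) (hε : FunctionSpaces.Torus.IsSmoothSpaceTimeOn S ε)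
    (hS : UniqueDiffOn ℝ S) {t : ℝ} (ht : t ∈ S) (x : UnitAddTorus d) :
    FunctionSpaces.Torus.timeDerivWithin S (fun s y => ‖b s y‖ ^ 2 / 2 + ε s y) t x =
      ⟪b t x, FunctionSpaces.Torus.timeDerivWithin S b t x⟫_ℝ +
        FunctionSpaces.Torus.timeDerivWithin S ε t x := by
  have h1 : HasDerivWithinAt (fun τ => ‖b τ x‖ ^ 2 / 2 + ε τ x)
      (2 * ⟪b t x, FunctionSpaces.Torus.timeDerivWithin S b t x⟫_ℝ / 2 +
        FunctionSpaces.Torus.timeDerivWithin S ε t x) S t :=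
    ((hb.hasDerivWithinAt_slice ht x).norm_sq.div_const 2).add (hε.hasDerivWithinAt_slice ht x)
  rw [show FunctionSpaces.Torus.timeDerivWithin S (fun s y => ‖b s y‖ ^ 2 / 2 + ε s y) t x =
      derivWithin (fun τ => ‖b τ x‖ ^ 2 / 2 + ε τ x) S t from rfl, h1.derivWithin (hS t ht)]
  ring

variable {ρ p ε : ℝ → UnitAddTorus d → ℝ} {u : ℝ → UnitAddTorus d → EuclideanSpace ℝ d}

/-- **Mass flux identity** (no equation used): for jointly smooth `ρ, u`,
`∂ₜρ + div(ρu) = ∂ₜρ + ∑ᵢ uᵢ ∂ᵢρ + ρ div u` pointwise. [folklore] -/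
theorem massFlux_identity (hρ : FunctionSpaces.Torus.IsSmoothSpaceTimeOn S ρ)
    (hu : FunctionSpaces.Torus.IsSmoothSpaceTimeOn S u) {t : ℝ} (ht : t ∈ S) (x : UnitAddTorus d) :
    FunctionSpaces.Torus.timeDerivWithin S ρ t x +
        FunctionSpaces.Torus.divergence (fun y => ρ t y • u t y) x =
      FunctionSpaces.Torus.timeDerivWithin S ρ t x +
        (∑ i, u t x i * FunctionSpaces.Torus.partialDeriv i (ρ t) x) +
        ρ t x * FunctionSpaces.Torus.divergence (u t) x := by
  rw [FunctionSpaces.Torus.divergence_smul ((hρ.isSmooth_slice ht).isContDiff (by simp))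
    ((hu.isSmooth_slice ht).isContDiff (by simp))]
  ring

/-- **Momentum flux identity** (no equation used): for jointly smooth `ρ, u, p` on a time set of
unique differentiability and `ρ(t, x) ≠ 0`,
`∂ₜ(ρu) + ∑ᵢ ∂ᵢ(ρ uᵢ u) + ∇p = ρ • (∂ₜu + ∑ᵢ uᵢ ∂ᵢu + ρ⁻¹ ∇p) + (∂ₜρ + div(ρu)) • u`
at `(t, x)` (Leibniz rules in `t` and `xᵢ`). [folklore] -/
theorem momentumFlux_identity (hρ : FunctionSpaces.Torus.IsSmoothSpaceTimeOn S ρ)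
    (hu : FunctionSpaces.Torus.IsSmoothSpaceTimeOn S u) (hS : UniqueDiffOn ℝ S) {t : ℝ} (ht : t ∈ S)
    (x : UnitAddTorus d) (hρ0 : ρ t x ≠ 0) :
    FunctionSpaces.Torus.timeDerivWithin S (fun s y => ρ s y • u s y) t x +
        (∑ i, FunctionSpaces.Torus.partialDeriv i (fun y => (ρ t y * u t y i) • u t y) x) +
        FunctionSpaces.Torus.gradient (p t) x =
      ρ t x • (FunctionSpaces.Torus.timeDerivWithin S u t x +
          (∑ i, u t x i • FunctionSpaces.Torus.partialDeriv i (u t) x) +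
          (ρ t x)⁻¹ • FunctionSpaces.Torus.gradient (p t) x) +
        (FunctionSpaces.Torus.timeDerivWithin S ρ t x +
          FunctionSpaces.Torus.divergence (fun y => ρ t y • u t y) x) • u t x := by
  have hρ1 : FunctionSpaces.Torus.IsContDiff 1 (ρ t) := (hρ.isSmooth_slice ht).isContDiff (by simp)
  have hu1 : FunctionSpaces.Torus.IsContDiff 1 (u t) := (hu.isSmooth_slice ht).isContDiff (by simp)
  have hρui : ∀ i, FunctionSpaces.Torus.IsContDiff 1 (fun y => ρ t y * u t y i) := fun i =>
    ContDiff.mul hρ1 (isContDiff_coord hu1 i)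
  -- Leibniz in time and in each `xᵢ`
  rw [timeDerivWithin_smul hρ hu hS ht x]
  simp_rw [FunctionSpaces.Torus.partialDeriv_smul (hρui _) hu1]
  -- `div(ρu) = ∑ᵢ ∂ᵢ(ρ uᵢ)`
  have hdiv : FunctionSpaces.Torus.divergence (fun y => ρ t y • u t y) x =
      ∑ i, FunctionSpaces.Torus.partialDeriv i (fun y => ρ t y * u t y i) x := rfl
  rw [hdiv, Finset.sum_add_distrib, smul_add, smul_add, add_smul, Finset.sum_smul, Finset.smul_sum,
    smul_smul, mul_inv_cancel₀ hρ0, one_smul]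
  simp_rw [smul_smul]
  abel

/-- **Energy flux identity** (no equation used): for jointly smooth `ρ, u, p, ε` on a time set
of unique differentiability and `ρ(t, x) ≠ 0`, with `k = ‖u‖²/2 + ε` and `E = ρ k`,
`∂ₜE + div((E + p)u) = k·(∂ₜρ + ∑ᵢ uᵢ∂ᵢρ + ρ div u) + ρ·⟪u, ∂ₜu + ∑ᵢ uᵢ∂ᵢu + ρ⁻¹∇p⟫
 + ρ·(∂ₜε + ∑ᵢ uᵢ∂ᵢε + p ρ⁻¹ div u)` at `(t, x)`. [folklore] -/
theorem energyFlux_identity (hρ : FunctionSpaces.Torus.IsSmoothSpaceTimeOn S ρ)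
    (hu : FunctionSpaces.Torus.IsSmoothSpaceTimeOn S u) (hp : FunctionSpaces.Torus.IsSmoothSpaceTimeOn S p)
    (hε : FunctionSpaces.Torus.IsSmoothSpaceTimeOn S ε) (hS : UniqueDiffOn ℝ S) {t : ℝ} (ht : t ∈ S)
    (x : UnitAddTorus d) (hρ0 : ρ t x ≠ 0) :
    FunctionSpaces.Torus.timeDerivWithin S (fun s y => ρ s y * (‖u s y‖ ^ 2 / 2 + ε s y)) t x +
        FunctionSpaces.Torus.divergence
          (fun y => (ρ t y * (‖u t y‖ ^ 2 / 2 + ε t y) + p t y) • u t y) x =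
      (‖u t x‖ ^ 2 / 2 + ε t x) *
          (FunctionSpaces.Torus.timeDerivWithin S ρ t x +
            (∑ i, u t x i * FunctionSpaces.Torus.partialDeriv i (ρ t) x) +
            ρ t x * FunctionSpaces.Torus.divergence (u t) x) +
        ρ t x * ⟪u t x, FunctionSpaces.Torus.timeDerivWithin S u t x +
            (∑ i, u t x i • FunctionSpaces.Torus.partialDeriv i (u t) x) +
            (ρ t x)⁻¹ • FunctionSpaces.Torus.gradient (p t) x⟫_ℝ +
        ρ t x * (FunctionSpaces.Torus.timeDerivWithin S ε t x +
            (∑ i, u t x i * FunctionSpaces.Torus.partialDeriv i (ε t) x) +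
            p t x * (ρ t x)⁻¹ * FunctionSpaces.Torus.divergence (u t) x) := by
  have hρ1 : FunctionSpaces.Torus.IsContDiff 1 (ρ t) := (hρ.isSmooth_slice ht).isContDiff (by simp)
  have hu1 : FunctionSpaces.Torus.IsContDiff 1 (u t) := (hu.isSmooth_slice ht).isContDiff (by simp)
  have hp1 : FunctionSpaces.Torus.IsContDiff 1 (p t) := (hp.isSmooth_slice ht).isContDiff (by simp)
  have hε1 : FunctionSpaces.Torus.IsContDiff 1 (ε t) := (hε.isSmooth_slice ht).isContDiff (by simp)
  have hk1 : FunctionSpaces.Torus.IsContDiff 1 (fun y => ‖u t y‖ ^ 2 / 2 + ε t y) :=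
    ContDiff.add ((hu1.norm_sq ℝ).div_const 2) hε1
  have hE1 : FunctionSpaces.Torus.IsContDiff 1 (fun y => ρ t y * (‖u t y‖ ^ 2 / 2 + ε t y)) :=
    ContDiff.mul hρ1 hk1
  have hEp1 : FunctionSpaces.Torus.IsContDiff 1 (fun y => ρ t y * (‖u t y‖ ^ 2 / 2 + ε t y) + p t y) :=
    ContDiff.add hE1 hp1
  -- joint smoothness of `k = ‖u‖²/2 + ε`
  have hk : FunctionSpaces.Torus.IsSmoothSpaceTimeOn S (fun s y => ‖u s y‖ ^ 2 / 2 + ε s y) := by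
    have h1 : FunctionSpaces.Torus.IsSmoothSpaceTimeOn S (fun s y => ‖u s y‖ ^ 2) := by
      change ContDiffOn ℝ ∞ (fun z => ‖FunctionSpaces.Torus.stLift u z‖ ^ 2) _
      exact hu.norm_sq ℝ
    exact (h1.div_const 2).add hε
  -- time derivative of `E = ρ k`
  rw [timeDerivWithin_mul hρ hk hS ht x, timeDerivWithin_half_norm_sq_add hu hε hS ht x]
  -- divergence of `(E + p) u`
  rw [FunctionSpaces.Torus.divergence_smul hEp1 hu1 x]
  -- `∂ᵢ(E + p) = ∂ᵢρ k + ρ (⟪u, ∂ᵢu⟫ + ∂ᵢε) + ∂ᵢp`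
  have hdi : ∀ i, FunctionSpaces.Torus.partialDeriv i
      (fun y => ρ t y * (‖u t y‖ ^ 2 / 2 + ε t y) + p t y) x =
      (ρ t x * (⟪u t x, FunctionSpaces.Torus.partialDeriv i (u t) x⟫_ℝ +
          FunctionSpaces.Torus.partialDeriv i (ε t) x) +
        FunctionSpaces.Torus.partialDeriv i (ρ t) x * (‖u t x‖ ^ 2 / 2 + ε t x)) +
        FunctionSpaces.Torus.partialDeriv i (p t) x := by
    intro i
    have hn1 : FunctionSpaces.Torus.IsContDiff 1 (fun y => ‖u t y‖ ^ 2 / 2) := (hu1.norm_sq ℝ).div_const 2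
    have hadd : FunctionSpaces.Torus.partialDeriv i
        (fun y => ρ t y * (‖u t y‖ ^ 2 / 2 + ε t y) + p t y) x =
        FunctionSpaces.Torus.partialDeriv i (fun y => ρ t y * (‖u t y‖ ^ 2 / 2 + ε t y)) x +
          FunctionSpaces.Torus.partialDeriv i (p t) x := by
      rw [show (fun y => ρ t y * (‖u t y‖ ^ 2 / 2 + ε t y) + p t y) =
          (fun y => ρ t y * (‖u t y‖ ^ 2 / 2 + ε t y)) + p t from rfl,
        FunctionSpaces.Torus.partialDeriv_add hE1 hp1 i, Pi.add_apply]
    have hkadd : FunctionSpaces.Torus.partialDeriv i (fun y => ‖u t y‖ ^ 2 / 2 + ε t y) x =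
        ⟪u t x, FunctionSpaces.Torus.partialDeriv i (u t) x⟫_ℝ +
          FunctionSpaces.Torus.partialDeriv i (ε t) x := by
      rw [show (fun y => ‖u t y‖ ^ 2 / 2 + ε t y) = (fun y => ‖u t y‖ ^ 2 / 2) + ε t from rfl,
        FunctionSpaces.Torus.partialDeriv_add hn1 hε1 i, Pi.add_apply, partialDeriv_half_norm_sq_eq_inner hu1 i x]
    rw [hadd, FunctionSpaces.Torus.partialDeriv_mul hρ1 hk1 i x, hkadd]
  simp_rw [hdi]
  -- the pressure pairing `⟪u, ρ⁻¹ ∇p⟫ = ρ⁻¹ ∑ᵢ uᵢ ∂ᵢp`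
  rw [inner_add_right, inner_add_right, real_inner_smul_right, inner_gradient_eq_sum hp1,
    inner_sum]
  simp_rw [real_inner_smul_right]
  -- bookkeeping: name the scalars and finish by `ring` summand-wise
  set r := ρ t x
  set K := ‖u t x‖ ^ 2 / 2 + ε t x
  set D := FunctionSpaces.Torus.divergence (u t) x
  set P := p t x
  have hsum : ∑ i, u t x i *
      ((r * (⟪u t x, FunctionSpaces.Torus.partialDeriv i (u t) x⟫_ℝ +
          FunctionSpaces.Torus.partialDeriv i (ε t) x) +
        FunctionSpaces.Torus.partialDeriv i (ρ t) x * K) +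
        FunctionSpaces.Torus.partialDeriv i (p t) x) =
      K * ∑ i, u t x i * FunctionSpaces.Torus.partialDeriv i (ρ t) x +
        r * ∑ i, u t x i * ⟪u t x, FunctionSpaces.Torus.partialDeriv i (u t) x⟫_ℝ +
        r * ∑ i, u t x i * FunctionSpaces.Torus.partialDeriv i (ε t) x +
        ∑ i, u t x i * FunctionSpaces.Torus.partialDeriv i (p t) x := by
    rw [Finset.mul_sum, Finset.mul_sum, Finset.mul_sum, ← Finset.sum_add_distrib,
      ← Finset.sum_add_distrib, ← Finset.sum_add_distrib]
    exact Finset.sum_congr rfl fun i _ => by ring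
  rw [hsum]
  have hrinv : r * r⁻¹ = 1 := mul_inv_cancel₀ hρ0
  linear_combination
    (-(∑ i, u t x i * FunctionSpaces.Torus.partialDeriv i (p t) x + P * D)) * hrinv

end Calculus

/-! ## The primitive form of the complete Euler system -/

/-- **Classical solution of the complete Euler system in PRIMITIVE variables on `S × 𝕋³`** for
the equation of state `eos`: `ρ, u, ϑ` jointly smooth on `S × 𝕋³`, `ρ, ϑ > 0`, and pointwise on
`S × 𝕋³` (one-sided time derivative within `S`)
`∂ₜρ + ∑ᵢ uᵢ∂ᵢρ + ρ div u = 0` (continuity),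
`∂ₜu + ∑ᵢ uᵢ∂ᵢu + ρ⁻¹ ∇p(ρ, ϑ) = 0` (Euler),
`∂ₜe(ρ,ϑ) + ∑ᵢ uᵢ∂ᵢe(ρ,ϑ) + (p(ρ,ϑ)/ρ) div u = 0` (internal energy) — the form in which the
system is a quasilinear symmetrisable hyperbolic system (Majda 1984, Ch. 1; Dafermos 2005,
§3.3.6). Equivalent to the conservation form `IsClassicalEulerSolutionOn` for smooth `p, e`
(`isClassicalEulerSolutionOn_iff_primitive`). [cite: Majda1984, Ch. 1 and Ch. 2 §2.1] -/
structure IsPrimitiveEulerSolutionOn (eos : EulerEOS) (S : Set ℝ) (ρ : ℝ → UnitAddTorus (Fin 3) → ℝ)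
    (u : ℝ → UnitAddTorus (Fin 3) → EuclideanSpace ℝ (Fin 3))
    (ϑ : ℝ → UnitAddTorus (Fin 3) → ℝ) : Prop where
  smooth_density : FunctionSpaces.Torus.IsSmoothSpaceTimeOn S ρ
  smooth_velocity : FunctionSpaces.Torus.IsSmoothSpaceTimeOn S u
  smooth_temperature : FunctionSpaces.Torus.IsSmoothSpaceTimeOn S ϑ
  density_pos : ∀ t ∈ S, ∀ x, 0 < ρ t x
  temperature_pos : ∀ t ∈ S, ∀ x, 0 < ϑ t x
  continuity : ∀ t ∈ S, ∀ x,
    FunctionSpaces.Torus.timeDerivWithin S ρ t x +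
        (∑ i, u t x i * FunctionSpaces.Torus.partialDeriv i (ρ t) x) +
      ρ t x * FunctionSpaces.Torus.divergence (u t) x = 0
  euler : ∀ t ∈ S, ∀ x,
    FunctionSpaces.Torus.timeDerivWithin S u t x +
        (∑ i, u t x i • FunctionSpaces.Torus.partialDeriv i (u t) x) +
      (ρ t x)⁻¹ • FunctionSpaces.Torus.gradient (fun y => eos.p (ρ t y) (ϑ t y)) x = 0
  ienergy : ∀ t ∈ S, ∀ x,
    FunctionSpaces.Torus.timeDerivWithin S (fun s y => eos.e (ρ s y) (ϑ s y)) t x +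
        (∑ i, u t x i * FunctionSpaces.Torus.partialDeriv i (fun y => eos.e (ρ t y) (ϑ t y)) x) +
      eos.p (ρ t x) (ϑ t x) * (ρ t x)⁻¹ * FunctionSpaces.Torus.divergence (u t) x = 0

variable {eos : EulerEOS} {S : Set ℝ}
  {ρ : ℝ → UnitAddTorus (Fin 3) → ℝ} {u : ℝ → UnitAddTorus (Fin 3) → EuclideanSpace ℝ (Fin 3)}
  {ϑ : ℝ → UnitAddTorus (Fin 3) → ℝ}

/-- A constitutive function smooth on the open quadrant, evaluated along jointly smooth fields
`ρ, ϑ > 0`, is a jointly smooth field. [folklore] -/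
theorem isSmoothSpaceTimeOn_comp_quadrant {g : ℝ → ℝ → ℝ}
    (hg : ContDiffOn ℝ ∞ (uncurry g) (Ioi 0 ×ˢ Ioi 0))
    (hρ : FunctionSpaces.Torus.IsSmoothSpaceTimeOn S ρ) (hϑ : FunctionSpaces.Torus.IsSmoothSpaceTimeOn S ϑ)
    (hρpos : ∀ t ∈ S, ∀ x, 0 < ρ t x) (hϑpos : ∀ t ∈ S, ∀ x, 0 < ϑ t x) :
    FunctionSpaces.Torus.IsSmoothSpaceTimeOn S (fun t y => g (ρ t y) (ϑ t y)) := by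
  have hpair : ContDiffOn ℝ ∞
      (fun z => (FunctionSpaces.Torus.stLift ρ z, FunctionSpaces.Torus.stLift ϑ z))
      (S ×ˢ (univ : Set (EuclideanSpace ℝ (Fin 3)))) := hρ.prodMk hϑ
  have hmaps : MapsTo (fun z => (FunctionSpaces.Torus.stLift ρ z, FunctionSpaces.Torus.stLift ϑ z))
      (S ×ˢ (univ : Set (EuclideanSpace ℝ (Fin 3)))) (Ioi 0 ×ˢ Ioi 0) := by
    rintro ⟨t, y⟩ ht
    exact ⟨hρpos t ht.1 _, hϑpos t ht.1 _⟩
  exact hg.comp hpair hmaps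

/-- **Conservative ⇔ primitive form for smooth solutions.** On a time set of unique
differentiability, for an equation of state whose `p` and `e` are smooth on `ρ, ϑ > 0`, a triple
of fields is a classical solution of the conservation laws (1.1)–(1.3)
(`IsClassicalEulerSolutionOn`) iff it is a classical solution in primitive variables
(`IsPrimitiveEulerSolutionOn`): by the three flux identities the conservative residuals are
`(mass) = (continuity)`, `(momentum) = ρ • (euler) + (mass) • u`,
`(energy) = k·(continuity) + ρ⟪u, (euler)⟫ + ρ·(ienergy)`, and `ρ > 0`
(Majda 1984, Ch. 1; Dafermos 2005, §3.3.6). [folklore] -/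
theorem isClassicalEulerSolutionOn_iff_primitive (hS : UniqueDiffOn ℝ S)
    (hp : ContDiffOn ℝ ∞ (uncurry eos.p) (Ioi 0 ×ˢ Ioi 0))
    (he : ContDiffOn ℝ ∞ (uncurry eos.e) (Ioi 0 ×ˢ Ioi 0)) :
    IsClassicalEulerSolutionOn eos S ρ u ϑ ↔ IsPrimitiveEulerSolutionOn eos S ρ u ϑ := by
  constructor
  · intro h
    have hP := isSmoothSpaceTimeOn_comp_quadrant hp h.smooth_density h.smooth_temperature
      h.density_pos h.temperature_pos
    have hE := isSmoothSpaceTimeOn_comp_quadrant he h.smooth_density h.smooth_temperature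
      h.density_pos h.temperature_pos
    have hc : ∀ t ∈ S, ∀ x, FunctionSpaces.Torus.timeDerivWithin S ρ t x +
        (∑ i, u t x i * FunctionSpaces.Torus.partialDeriv i (ρ t) x) +
        ρ t x * FunctionSpaces.Torus.divergence (u t) x = 0 := fun t ht x => by
      rw [← massFlux_identity h.smooth_density h.smooth_velocity ht x]
      exact h.mass t ht x
    have heu : ∀ t ∈ S, ∀ x, FunctionSpaces.Torus.timeDerivWithin S u t x +
        (∑ i, u t x i • FunctionSpaces.Torus.partialDeriv i (u t) x) +
        (ρ t x)⁻¹ • FunctionSpaces.Torus.gradient (fun y => eos.p (ρ t y) (ϑ t y)) x = 0 := by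
      intro t ht x
      have hρ0 : ρ t x ≠ 0 := (h.density_pos t ht x).ne'
      have key := momentumFlux_identity (p := fun s y => eos.p (ρ s y) (ϑ s y)) h.smooth_density
        h.smooth_velocity hS ht x hρ0
      rw [h.momentum t ht x, h.mass t ht x, zero_smul, add_zero] at key
      exact (smul_eq_zero.1 key.symm).resolve_left hρ0
    refine ⟨h.smooth_density, h.smooth_velocity, h.smooth_temperature, h.density_pos,
      h.temperature_pos, hc, heu, fun t ht x => ?_⟩
    have hρ0 : ρ t x ≠ 0 := (h.density_pos t ht x).ne'
    have key := energyFlux_identity h.smooth_density h.smooth_velocity hP hE hS ht x hρ0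
    rw [h.energy t ht x, hc t ht x, heu t ht x, inner_zero_right, mul_zero, mul_zero, zero_add,
      zero_add] at key
    exact (mul_eq_zero.1 key.symm).resolve_left hρ0
  · intro h
    have hP := isSmoothSpaceTimeOn_comp_quadrant hp h.smooth_density h.smooth_temperature
      h.density_pos h.temperature_pos
    have hE := isSmoothSpaceTimeOn_comp_quadrant he h.smooth_density h.smooth_temperature
      h.density_pos h.temperature_pos
    have hm : ∀ t ∈ S, ∀ x, FunctionSpaces.Torus.timeDerivWithin S ρ t x +
        FunctionSpaces.Torus.divergence (fun y => ρ t y • u t y) x = 0 := fun t ht x => by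
      rw [massFlux_identity h.smooth_density h.smooth_velocity ht x]
      exact h.continuity t ht x
    refine ⟨h.smooth_density, h.smooth_velocity, h.smooth_temperature, h.density_pos,
      h.temperature_pos, hm, fun t ht x => ?_, fun t ht x => ?_⟩
    · have hρ0 : ρ t x ≠ 0 := (h.density_pos t ht x).ne'
      rw [momentumFlux_identity (p := fun s y => eos.p (ρ s y) (ϑ s y)) h.smooth_density
        h.smooth_velocity hS ht x hρ0, h.euler t ht x, hm t ht x, smul_zero, zero_smul, add_zero]
    · have hρ0 : ρ t x ≠ 0 := (h.density_pos t ht x).ne'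
      rw [energyFlux_identity h.smooth_density h.smooth_velocity hP hE hS ht x hρ0,
        h.continuity t ht x, h.euler t ht x, h.ienergy t ht x, inner_zero_right]
      ring

/-- Conservative solutions are primitive solutions (one direction of
`isClassicalEulerSolutionOn_iff_primitive`, dot notation). [folklore] -/
theorem IsClassicalEulerSolutionOn.primitive (h : IsClassicalEulerSolutionOn eos S ρ u ϑ)
    (hS : UniqueDiffOn ℝ S) (hp : ContDiffOn ℝ ∞ (uncurry eos.p) (Ioi 0 ×ˢ Ioi 0))
    (he : ContDiffOn ℝ ∞ (uncurry eos.e) (Ioi 0 ×ˢ Ioi 0)) : IsPrimitiveEulerSolutionOn eos S ρ u ϑ :=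
  (isClassicalEulerSolutionOn_iff_primitive hS hp he).1 h

/-- Primitive solutions are conservative solutions (the other direction, dot notation). [folklore] -/
theorem IsPrimitiveEulerSolutionOn.classical (h : IsPrimitiveEulerSolutionOn eos S ρ u ϑ)
    (hS : UniqueDiffOn ℝ S) (hp : ContDiffOn ℝ ∞ (uncurry eos.p) (Ioi 0 ×ˢ Ioi 0))
    (he : ContDiffOn ℝ ∞ (uncurry eos.e) (Ioi 0 ×ˢ Ioi 0)) : IsClassicalEulerSolutionOn eos S ρ u ϑ :=
  (isClassicalEulerSolutionOn_iff_primitive hS hp he).2 h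

/-! ## The monatomic athermal law `p = ρ ϑ ζ(ρ)`, `e = 3ϑ/2` -/

section Monatomic

variable {ζ f : ℝ → ℝ}

/-- The pressure `p = ρϑζ(ρ)` of `monatomicExcess ζ f` is smooth (everywhere) when `ζ` is. [folklore] -/
theorem contDiff_monatomicExcess_p (hζ : ContDiff ℝ ∞ ζ) :
    ContDiff ℝ ∞ (uncurry (EulerEOS.monatomicExcess ζ f).p) := by
  have h : uncurry (EulerEOS.monatomicExcess ζ f).p = fun q : ℝ × ℝ => q.1 * q.2 * ζ q.1 := by
    funext q; rfl
  rw [h]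
  exact (contDiff_fst.mul contDiff_snd).mul (hζ.comp contDiff_fst)

/-- The internal energy `e = 3ϑ/2` of `monatomicExcess ζ f` is smooth (everywhere). [folklore] -/
theorem contDiff_monatomicExcess_e :
    ContDiff ℝ ∞ (uncurry (EulerEOS.monatomicExcess ζ f).e) := by
  have h : uncurry (EulerEOS.monatomicExcess ζ f).e = fun q : ℝ × ℝ => 3 / 2 * q.2 := by
    funext q; rfl
  rw [h]
  exact contDiff_const.mul contDiff_snd

/-- For `e = 3ϑ/2` the internal-energy residual is `3/2` times the temperature residual:
`∂ₜe + ∑ᵢuᵢ∂ᵢe + (p/ρ) div u = (3/2)(∂ₜϑ + ∑ᵢuᵢ∂ᵢϑ + (2/3) ϑ ζ(ρ) div u)` for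
`p = ρϑζ(ρ)`, `ρ ≠ 0`, jointly smooth `ϑ`. [folklore] -/
theorem ienergyResidual_monatomicExcess (hϑ : FunctionSpaces.Torus.IsSmoothSpaceTimeOn S ϑ)
    (hS : UniqueDiffOn ℝ S) {t : ℝ} (ht : t ∈ S) (x : UnitAddTorus (Fin 3)) (hρ0 : ρ t x ≠ 0) :
    FunctionSpaces.Torus.timeDerivWithin S
          (fun s y => (EulerEOS.monatomicExcess ζ f).e (ρ s y) (ϑ s y)) t x +
        (∑ i, u t x i * FunctionSpaces.Torus.partialDeriv i
          (fun y => (EulerEOS.monatomicExcess ζ f).e (ρ t y) (ϑ t y)) x) +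
        (EulerEOS.monatomicExcess ζ f).p (ρ t x) (ϑ t x) * (ρ t x)⁻¹ *
          FunctionSpaces.Torus.divergence (u t) x =
      3 / 2 * (FunctionSpaces.Torus.timeDerivWithin S ϑ t x +
        (∑ i, u t x i * FunctionSpaces.Torus.partialDeriv i (ϑ t) x) +
        2 / 3 * (ϑ t x * ζ (ρ t x)) * FunctionSpaces.Torus.divergence (u t) x) := by
  have he : (fun s y => (EulerEOS.monatomicExcess ζ f).e (ρ s y) (ϑ s y)) = fun s y => (3 / 2 : ℝ) • ϑ s y := by
    funext s y; simp [EulerEOS.monatomicExcess, smul_eq_mul]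
  have het : (fun y => (EulerEOS.monatomicExcess ζ f).e (ρ t y) (ϑ t y)) = fun y => (3 / 2 : ℝ) • ϑ t y := by
    funext y; simp [EulerEOS.monatomicExcess, smul_eq_mul]
  have hp : (EulerEOS.monatomicExcess ζ f).p (ρ t x) (ϑ t x) = ρ t x * ϑ t x * ζ (ρ t x) := rfl
  have hϑ1 : FunctionSpaces.Torus.IsContDiff 1 (ϑ t) := (hϑ.isSmooth_slice ht).isContDiff (by simp)
  -- time derivative of `(3/2) ϑ`
  have hdt : FunctionSpaces.Torus.timeDerivWithin S (fun s y => (3 / 2 : ℝ) • ϑ s y) t x =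
      (3 / 2 : ℝ) • FunctionSpaces.Torus.timeDerivWithin S ϑ t x :=
    ((hϑ.hasDerivWithinAt_slice ht x).const_smul (3 / 2 : ℝ)).derivWithin (hS t ht)
  -- partial derivatives of `(3/2) ϑ`
  have hdi : ∀ i, FunctionSpaces.Torus.partialDeriv i (fun y => (3 / 2 : ℝ) • ϑ t y) x =
      (3 / 2 : ℝ) • FunctionSpaces.Torus.partialDeriv i (ϑ t) x := by
    intro i
    rw [show (fun y => (3 / 2 : ℝ) • ϑ t y) = (3 / 2 : ℝ) • ϑ t from rfl,
      FunctionSpaces.Torus.partialDeriv_const_smul hϑ1, Pi.smul_apply]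
  rw [he, het, hdt, hp]
  simp_rw [hdi, smul_eq_mul]
  have hs : ∑ i, u t x i * ((3 / 2 : ℝ) * FunctionSpaces.Torus.partialDeriv i (ϑ t) x) =
      3 / 2 * ∑ i, u t x i * FunctionSpaces.Torus.partialDeriv i (ϑ t) x := by
    rw [Finset.mul_sum]
    exact Finset.sum_congr rfl fun i _ => by ring
  rw [hs]
  field_simp

/-- **The temperature equation of a primitive solution with the monatomic athermal law**:
`∂ₜϑ + ∑ᵢ uᵢ∂ᵢϑ + (2/3) ϑ ζ(ρ) div u = 0` (the internal-energy equation divided by `3/2`).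
[cite: Majda1984, Ch. 1 and Ch. 2 §2.1] -/
theorem IsPrimitiveEulerSolutionOn.temperature_eq
    (h : IsPrimitiveEulerSolutionOn (EulerEOS.monatomicExcess ζ f) S ρ u ϑ) (hS : UniqueDiffOn ℝ S)
    {t : ℝ} (ht : t ∈ S) (x : UnitAddTorus (Fin 3)) :
    FunctionSpaces.Torus.timeDerivWithin S ϑ t x +
        (∑ i, u t x i * FunctionSpaces.Torus.partialDeriv i (ϑ t) x) +
        2 / 3 * (ϑ t x * ζ (ρ t x)) * FunctionSpaces.Torus.divergence (u t) x = 0 := by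
  have key := h.ienergy t ht x
  rw [ienergyResidual_monatomicExcess h.smooth_temperature hS ht x (h.density_pos t ht x).ne'] at key
  have h32 : (3 / 2 : ℝ) ≠ 0 := by norm_num
  exact (mul_eq_zero.1 key).resolve_left h32

/-- **Primitive solutions for the monatomic athermal law from the temperature equation.**
Jointly smooth `ρ, u, ϑ` on a time set of unique differentiability with `ρ, ϑ > 0` satisfying
continuity, Euler and `∂ₜϑ + ∑ᵢ uᵢ∂ᵢϑ + (2/3) ϑ ζ(ρ) div u = 0` form a primitive — hence, by
`IsPrimitiveEulerSolutionOn.classical`, a classical — solution for `monatomicExcess ζ f`.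
[cite: Majda1984, Ch. 1 and Ch. 2 §2.1] -/
theorem IsPrimitiveEulerSolutionOn.of_monatomicExcess (hS : UniqueDiffOn ℝ S)
    (hρ : FunctionSpaces.Torus.IsSmoothSpaceTimeOn S ρ) (hu : FunctionSpaces.Torus.IsSmoothSpaceTimeOn S u)
    (hϑ : FunctionSpaces.Torus.IsSmoothSpaceTimeOn S ϑ)
    (hρpos : ∀ t ∈ S, ∀ x, 0 < ρ t x) (hϑpos : ∀ t ∈ S, ∀ x, 0 < ϑ t x)
    (hc : ∀ t ∈ S, ∀ x, FunctionSpaces.Torus.timeDerivWithin S ρ t x +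
        (∑ i, u t x i * FunctionSpaces.Torus.partialDeriv i (ρ t) x) +
      ρ t x * FunctionSpaces.Torus.divergence (u t) x = 0)
    (heu : ∀ t ∈ S, ∀ x, FunctionSpaces.Torus.timeDerivWithin S u t x +
        (∑ i, u t x i • FunctionSpaces.Torus.partialDeriv i (u t) x) +
      (ρ t x)⁻¹ • FunctionSpaces.Torus.gradient
        (fun y => (EulerEOS.monatomicExcess ζ f).p (ρ t y) (ϑ t y)) x = 0)
    (hte : ∀ t ∈ S, ∀ x, FunctionSpaces.Torus.timeDerivWithin S ϑ t x +
        (∑ i, u t x i * FunctionSpaces.Torus.partialDeriv i (ϑ t) x) +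
        2 / 3 * (ϑ t x * ζ (ρ t x)) * FunctionSpaces.Torus.divergence (u t) x = 0) :
    IsPrimitiveEulerSolutionOn (EulerEOS.monatomicExcess ζ f) S ρ u ϑ where
  smooth_density := hρ
  smooth_velocity := hu
  smooth_temperature := hϑ
  density_pos := hρpos
  temperature_pos := hϑpos
  continuity := hc
  euler := heu
  ienergy t ht x := by
    rw [ienergyResidual_monatomicExcess hϑ hS ht x (hρpos t ht x).ne', hte t ht x, mul_zero]

/-- **Classical solutions for the monatomic athermal law from the primitive system** on
`[0, T) × 𝕋³`: the form in which the local existence theorem delivers them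
(`IsPrimitiveEulerSolutionOn.of_monatomicExcess`, `IsPrimitiveEulerSolutionOn.classical`,
`isClassicalEulerSolutionOn_Ico_iff`). [cite: Majda1984, Ch. 2 §2.1 Thm 2.1] -/
theorem isClassicalEulerSolution_monatomicExcess_of_primitive {T : ℝ} (hζ : ContDiff ℝ ∞ ζ)
    (h : IsPrimitiveEulerSolutionOn (EulerEOS.monatomicExcess ζ f) (Ico 0 T) ρ u ϑ) :
    IsClassicalEulerSolution (EulerEOS.monatomicExcess ζ f) T ρ u ϑ :=
  isClassicalEulerSolutionOn_Ico_iff.1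
    (h.classical (uniqueDiffOn_Ico 0 T) (contDiff_monatomicExcess_p hζ).contDiffOn
      contDiff_monatomicExcess_e.contDiffOn)

/-- **The primitive system satisfied by a classical solution with the monatomic athermal law**
on `[0, T) × 𝕋³` (the form consumed by the energy estimates of the continuation argument).
[cite: Majda1984, Ch. 2 §2.1 Thm 2.2] -/
theorem IsClassicalEulerSolution.primitive_monatomicExcess {T : ℝ} (hζ : ContDiff ℝ ∞ ζ)
    (h : IsClassicalEulerSolution (EulerEOS.monatomicExcess ζ f) T ρ u ϑ) :
    IsPrimitiveEulerSolutionOn (EulerEOS.monatomicExcess ζ f) (Ico 0 T) ρ u ϑ :=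
  (isClassicalEulerSolutionOn_Ico_iff.2 h).primitive (uniqueDiffOn_Ico 0 T)
    (contDiff_monatomicExcess_p hζ).contDiffOn contDiff_monatomicExcess_e.contDiffOn

end Monatomic

end CompressibleEuler

end Literature.Analysis.FluidPDE

end
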